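import Mathlib
import Summits.Ventures.HodgeRepro2.T6N42FlathLift

/-!
# T6N42FlathLiftHost — the SEAM to the host: the first lift `π₀ = Θ_{V′→W₁₂}(β′)` as a host object
over the N3 side's carriers, and the `GlobalLiftDatum` it yields (owner t6-p5)

`T6N42FlathLift.lean` discharges the residual `hFL` from a `GlobalLiftDatum` (the global theta map
`ω_𝔸 → π₀ ⊠ β′`, non-zero, equivariant) read at each non-split place. t6-p3's STAGE 0 host datum
(`N3SideRich`, in the tree since WAVE 1) carries `L²([H])` with the right translation `R : H(𝔸_f) → L²([H]) →ₗᵢ L²([H])`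
and `π₀ ⊂ L²([H])` as a submodule — the SECOND lift's objects (`K_ψ`, `Θ_V(π₀) ⊂ L²([G])`), NOT the
first lift's. This file names the first lift's objects over exactly those carrier types, so that the
host instance's `hFL` side is a fill-in of one structure per side:

`FirstLiftSide LH Hf R π₀` = TIER5 (E1) as DATA (route/TIER5.md v0.57 l. 464: «π₀ := Θ_{V′→W₁₂}(β′)
⊂ L²([U(W₁₂)]) irreducible cuspidal (E1)»): the group `H′(𝔸_f) = U(V′)(𝔸_f)`, the finite Schwartz
data `S′` of the pair `(U(W₁₂), U(V′))` with the Weil representation `ω` of `H(𝔸_f) × H′(𝔸_f)`, the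
character `β′` of `H′(𝔸_f)`, the theta map `θ : S′ → π₀`, `φ ↦ θ_φ(β′)` — OBJECTS only. Its LAWS are
the separate `Prop`-structure `FirstLiftSide.IsLift` (t6-p3's form, STATUS l. 12531, so that p3's
binder census counts them by name: «1 DATA + 5 RESIDUAL laws» per side): `θ ≠ 0` ((E1): `π₀ ≠ 0`),
the covariance `θ (ω (h, h′) φ) = β′(h′) • R h (θ φ)` (the theta integral's equivariance in `(h, h′)`),
the stability of `π₀` under `R` and the two hom laws of `R` (interface Props of `T6N3Interface` in
t6-p3's lane, stated here so that `π₀` is a representation of `H(𝔸_f)`). Nothing is constructed.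

`FirstLiftSide.πA : Representation ℂ Hf π₀` (right translation restricted to `π₀`, under the laws) and
**`FirstLiftSide.toGlobalLiftDatum : GlobalLiftDatum`** with **`isLift_toGlobalLiftDatum`** (`Θ :=
rid⁻¹ ∘ θ`; `Θ ≠ 0`; the equivariance `Θ (ω x φ) = (πA ⊠ charLinRep β′) x (Θ φ)` from the
covariance law) — so `hFL` on the host = ONE `FirstLiftSide` (+ its `IsLift`) per side + ONE
`ReadAtPlace` (+ its `IsReading`) per non-split place (`T6N42FlathLift.FirstLiftReading`).

Proof lane (structure, `def`s, theorems; no display — nothing here is a printed statement).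
README §8(d): uses an L-value-free non-vanishing device: NO (TIER5 §N4.2 / §B, pre-02:16Z lines of
record, continued).

Filed in Tier-6 WAVE 1 as p437839 (proposed 2026-08-26T10:24:12Z, ACCEPTED, commit 3b72fa5f976b);
this v2 differs from the filed bytes in this module docstring only (the staged-record wording
dropped; every declaration byte-identical to v1).
-/

namespace Summit.Ventures.HodgeRepro2.T6.N42Flath

open Summit.Ventures.HodgeRepro2
open Summit.Ventures.HodgeRepro2.T5SplittingTwist
open Summit.Ventures.HodgeRepro2.T5TrivialPartner
open TensorProduct

/-- THE FIRST LIFT AS A HOST OBJECT (TIER5 (E1)) over the N3 side's carriers — `L²([H])` (`LH`),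
`H(𝔸_f)` (`Hf`), the right translation `R` and `π₀ ⊂ L²([H])` (the field types of t6-p3's `N3Side` /
`N3SideRich`), OBJECTS: the group `H′(𝔸_f) = U(V′)(𝔸_f)`, the finite Schwartz data `S′` of the pair
`(U(W₁₂), U(V′))` with the Weil representation `ω` of `H(𝔸_f) × H′(𝔸_f)`, the character `β′` of
`H′(𝔸_f)`, and the theta map `θ : S′ → π₀`, `φ ↦ θ_φ(β′)`. Its laws are `IsLift`. -/
structure FirstLiftSide (LH : Type) [NormedAddCommGroup LH] [InnerProductSpace ℂ LH]
    (Hf : Type) [Group Hf] (R : Hf → LH →ₗᵢ[ℂ] LH) (π₀ : Submodule ℂ LH) where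
  /-- `H′(𝔸_f) = U(V′)(𝔸_f)` -/
  H'f : Type
  [instGroup : Group H'f]
  /-- the finite Schwartz data `S′` of the pair `(U(W₁₂), U(V′))` -/
  S' : Type
  [instAdd : AddCommGroup S']
  [instMod : Module ℂ S']
  /-- the Weil representation of `H(𝔸_f) × H′(𝔸_f)` on `S′` -/
  ω : Representation ℂ (Hf × H'f) S'
  /-- the character `β′` of `H′(𝔸_f)` -/
  β' : H'f →* ℂˣ
  /-- the theta map `φ ↦ θ_φ(β′) ∈ π₀` -/
  θ : S' →ₗ[ℂ] π₀

namespace FirstLiftSide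

variable {LH : Type} [NormedAddCommGroup LH] [InnerProductSpace ℂ LH] {Hf : Type} [Group Hf]
  {R : Hf → LH →ₗᵢ[ℂ] LH} {π₀ : Submodule ℂ LH} (F : FirstLiftSide LH Hf R π₀)

/-- The group structure of `H′(𝔸_f)`. -/
instance instGroup' : Group F.H'f := F.instGroup

/-- The additive group of `S′`. -/
instance instAdd' : AddCommGroup F.S' := F.instAdd

/-- The `ℂ`-module structure of `S′`. -/
instance instMod' : Module ℂ F.S' := F.instMod

/-- The LAWS of a first-lift side: (E1) `θ ≠ 0`; the hom laws of the right translation `R`; the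
stability of `π₀` under `R`; the covariance of the theta integral `θ (ω (h, h′) φ) = β′(h′) • R h (θ φ)`.
-/
structure IsLift (F : FirstLiftSide LH Hf R π₀) : Prop where
  /-- (E1): the theta map is non-zero -/
  θ_ne_zero : F.θ ≠ 0
  /-- `R 1 = id` -/
  R_one : ∀ v, R 1 v = v
  /-- `R (h h′) = R h ∘ R h′` -/
  R_mul : ∀ h h' v, R (h * h') v = R h (R h' v)
  /-- `π₀` is stable under right translation -/
  π₀_stable : ∀ h v, v ∈ π₀ → R h v ∈ π₀
  /-- the covariance of the theta integral: `θ (ω (h, h′) φ) = β′(h′) • R h (θ φ)` -/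
  θ_equivariant : ∀ h h' φ, (F.θ (F.ω (h, h') φ) : LH) = (F.β' h' : ℂ) • R h (F.θ φ)

variable (hF : F.IsLift)

/-- Right translation by `h`, restricted to `π₀` (under the stability law). -/
def πALin (hF : F.IsLift) (h : Hf) : π₀ →ₗ[ℂ] π₀ :=
  (R h).toLinearMap.restrict (fun v hv => hF.π₀_stable h v hv)

/-- `πALin` applied, in `L²([H])`. -/
theorem πALin_apply_coe (hF : F.IsLift) (h : Hf) (v : π₀) : (F.πALin hF h v : LH) = R h v := rfl

/-- `π₀` as a representation of `H(𝔸_f)` (right translation, under the laws). -/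
def πA (hF : F.IsLift) : Representation ℂ Hf π₀ where
  toFun := F.πALin hF
  map_one' := by
    ext v
    simp [πALin_apply_coe, hF.R_one]
  map_mul' := fun h h' => by
    ext v
    simp [πALin_apply_coe, hF.R_mul]

/-- `πA` applied, in `L²([H])`. -/
theorem πA_apply_coe (hF : F.IsLift) (h : Hf) (v : π₀) : (F.πA hF h v : LH) = R h v := rfl

/-- The theta map into `π₀ ⊗ ℂ`. -/
def Θ : F.S' →ₗ[ℂ] π₀ ⊗[ℂ] ℂ :=
  (TensorProduct.rid ℂ π₀).symm.toLinearMap ∘ₗ F.θ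

/-- `Θ` applied. -/
theorem Θ_apply (φ : F.S') : F.Θ φ = F.θ φ ⊗ₜ[ℂ] (1 : ℂ) := by
  simp [Θ, TensorProduct.rid_symm_apply]

/-- `Θ` is non-zero (under (E1)). -/
theorem Θ_ne_zero (hF : F.IsLift) : F.Θ ≠ 0 := by
  intro h
  apply hF.θ_ne_zero
  ext φ
  have h1 := LinearMap.congr_fun h φ
  simp only [Θ, LinearMap.comp_apply, LinearEquiv.coe_coe, LinearMap.zero_apply] at h1
  simpa using (TensorProduct.rid ℂ π₀).symm.map_eq_zero_iff.mp h1

/-- `Θ` intertwines `ω` with `πA ⊠ charLinRep β′` (under the covariance law). -/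
theorem Θ_intertwining (hF : F.IsLift) :
    F.ω.IsIntertwiningMap (extTprod (F.πA hF) (charLinRep F.β')) F.Θ := by
  refine ⟨fun x φ => ?_⟩
  rw [Θ_apply, Θ_apply, extTprod_apply, TensorProduct.map_tmul, charLinRep_apply, mul_one]
  have h1 : (F.πA hF x.1) (F.θ φ) ⊗ₜ[ℂ] (F.β' x.2 : ℂ) =
      ((F.β' x.2 : ℂ) • (F.πA hF x.1) (F.θ φ)) ⊗ₜ[ℂ] (1 : ℂ) := by
    rw [TensorProduct.smul_tmul, smul_eq_mul, mul_one]
  rw [h1]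
  congr 1
  ext
  simp [πA_apply_coe, hF.θ_equivariant]

/-- **The seam**: a first-lift side (under its laws) yields the global lift datum of
`T6N42FlathLift.lean`. -/
def toGlobalLiftDatum (hF : F.IsLift) : GlobalLiftDatum where
  GA := Hf
  HA := F.H'f
  Ω := F.S'
  ωA := F.ω
  Vπ := π₀
  πA := F.πA hF
  βA := F.β'
  Θ := F.Θ

/-- … and it is a lift. -/
theorem isLift_toGlobalLiftDatum (hF : F.IsLift) : (F.toGlobalLiftDatum hF).IsLift where
  Θ_ne_zero := F.Θ_ne_zero hF
  Θ_intertwining := F.Θ_intertwining hF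

/-- The global partner of the first lift: `Hom_{H(𝔸_f)×H′(𝔸_f)}(ω, π₀ ⊠ β′) ≠ 0`. -/
theorem hasPartner (hF : F.IsLift) :
    T5DualPairSwap.HasPartner F.ω (F.πA hF) (charLinRep F.β') :=
  (F.toGlobalLiftDatum hF).hasPartner (F.isLift_toGlobalLiftDatum hF)

end FirstLiftSide

/-- The toy first-lift side (§10.5(ii)(c)): `L²([H]) = ℂ`, `H(𝔸_f) = H′(𝔸_f) = 1`, `R = id`,
`π₀ = ⊤`, `S′ = ℂ` with the trivial Weil representation, `β′ = 1`, `θ = id`. -/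
noncomputable def toyFirstLiftSide :
    FirstLiftSide ℂ Unit (fun _ => LinearIsometry.id) (⊤ : Submodule ℂ ℂ) where
  H'f := Unit
  S' := ℂ
  ω := Representation.trivial ℂ (Unit × Unit) ℂ
  β' := 1
  θ := (Submodule.topEquiv (R := ℂ) (M := ℂ)).symm.toLinearMap

/-- … and it satisfies the laws. -/
theorem toyFirstLiftSide_isLift : toyFirstLiftSide.IsLift where
  θ_ne_zero := fun h => by
    have h' : (Submodule.topEquiv (R := ℂ) (M := ℂ)).symm.toLinearMap =
        (0 : ℂ →ₗ[ℂ] (⊤ : Submodule ℂ ℂ)) := h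
    have h1 := LinearMap.congr_fun h' 1
    simp at h1
  R_one := fun _ => rfl
  R_mul := fun _ _ _ => rfl
  π₀_stable := fun _ _ _ => Submodule.mem_top
  θ_equivariant := fun h h' φ => by
    show (((Submodule.topEquiv (R := ℂ) (M := ℂ)).symm
        ((Representation.trivial ℂ (Unit × Unit) ℂ) (h, h') φ) : (⊤ : Submodule ℂ ℂ)) : ℂ) =
      (((1 : Unit →* ℂˣ) h' : ℂˣ) : ℂ) •
        (LinearIsometry.id : ℂ →ₗᵢ[ℂ] ℂ) ((Submodule.topEquiv (R := ℂ) (M := ℂ)).symm φ : ℂ)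
    simp [Representation.trivial]

/-- The toy global lift datum from the toy first-lift side, with its laws. -/
noncomputable def toyGlobalOfSide : GlobalLiftDatum :=
  toyFirstLiftSide.toGlobalLiftDatum toyFirstLiftSide_isLift

/-- … and it is a lift. -/
theorem toyGlobalOfSide_isLift : toyGlobalOfSide.IsLift :=
  toyFirstLiftSide.isLift_toGlobalLiftDatum toyFirstLiftSide_isLift

end Summit.Ventures.HodgeRepro2.T6.N42Flath
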